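/-
Copyright: see repository. [cite: CossartPiltant2008, Section 9, Lemma 9.4 (HAL p. 29 l. 48–49)]
-/
import Literature.AlgebraicGeometry.CossartPiltant200819.MonomialChartFibre2008

/-!
# Cossart–Piltant 2008, Lemma 9.4 — node N2a″ carved: the reduction of the affine chart `S[y]`
  modulo the `y_i` of positive value to polynomials in the `y_i` of value `0` is PROVED
  ("by (b)"); the monomial-chart leaf becomes a statement about `S[Y_{I₀}] → κ(W)`

[CP-I] V. Cossart, O. Piltant, *Resolution of singularities of threefolds in positive
characteristic. I.*, J. Algebra **320** (2008) 1051–1082, HAL hal-00139124 (page/line locators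
"HAL p. N l. M" refer to the HAL version, as in the rest of this directory).

`MonomialChartFibre2008` reduced the §9 monomial chart of Lemma 9.4 (HAL p. 29 l. 48–49:
"`S̄ := S[y₁, y₂, y₃]`. By (c), `S₁ := S̄_{m_W ∩ S̄}` is a local model of `W` and `S₁` is regular
by (b)") to the localisation-free leaf `MonomialChartIdeal` about the centre `𝔭 = m_W ∩ S̄` of
`W` on the affine chart.  This file PROVES the role of property (b) (`ℕ³ ⊆ ℕv₁ + ℕv₂ + ℕv₃`,
i.e. `C = V⁻¹ ≥ 0`, HAL p. 29 l. 28) in that statement and leaves the leaf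

* `MonomialChartKernel` (HYPOTHESIS — no `G`, no coefficients, no localisation, no `x`, no `V`):
  for a local model `S` of `W` (`κ(W)/k` algebraic) and finitely many `y_i ∈ W`, the ideal
  `𝔔 := {Q ∈ S[Y_{I₀}] | W(Q(y_{I₀})) > 0}` (`I₀ := {i | W(y_i) = 0}`), i.e. the kernel of
  `S[Y_{I₀}] → κ(W)`, is generated by `m_S` and `#I₀` of its elements — on paper: `𝔔 ⊇ m_S·S[Y]`
  and `𝔔/m_S·S[Y] ⊆ κ(S)[Y_{I₀}]` is the kernel of `Y ↦ ȳ ∈ κ(W)`, a maximal ideal since the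
  `ȳ_i` are algebraic over `k ⊆ κ(S)`, hence generated by `#I₀` elements (maximal ideals of a
  polynomial ring in `n` variables over a field are `n`-generated, Matsumura, *Commutative Ring
  Theory*, Thm. 5.1);

and PROVES the glue `monomialChartIdeal_of_kernel : MonomialChartKernel → MonomialChartIdeal`
("by (b)"): every element of `S̄ = S[y]` is a polynomial in `y` over `S`
(`exists_mvPolynomial_aeval_eq`); modulo the ideal generated by the `y_i` of positive value it
is a polynomial in `y_{I₀}` alone (`exists_eval₂_sub_eval₂_mem`); the constants from `m_S` lie in
that ideal because `m_S = (x)` and `x_j = ∏ y_i^{C_{ji}}` with some `C_{ji} ≥ 1`, `W(y_i) > 0`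
(`eq_prod_pow_toNat_of_mul_eq_one`, E441); hence `𝔭` is generated by the `y_i` of positive
value and the values of the `#I₀` generators of `𝔔`.

Re-threading (PROVED): nodes N2a′, N2a, N2, the Roots leaf of HAL p. 29 l. 14–65
(`tamePrimeDescentViaStableModelRoots_of_kernel`), Lemma 9.4 for inertial `W`, and the
directory's dependency statements with `MonomialChartKernel` as the §9 leaf.
-/

namespace Literature.AlgebraicGeometry.CossartPiltant200819.CP2008

open Literature.AlgebraicGeometry.Resolution IsLocalRing
open scoped Pointwise

universe u

/-! ## The leaf: the kernel of `S[Y_{I₀}] → κ(W)` -/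

section

/-- **Node N2a‴ (HYPOTHESIS; the commutative-algebra core of the §9 monomial chart).** [CP-I]
Lemma 9.4, HAL p. 29 l. 48–49 ("`S₁ := S̄_{m_W ∩ S̄}` is a local model of `W` and `S₁` is
regular"), core statement.  For a local model `S` of `W` over `k` with `κ(W)/k` algebraic and
elements `y_0, …, y_{d-1} ∈ W`, put `I₀ := {i | W(y_i) = 0}`; then there are
`m = d - #{i | W(y_i) > 0}` (`= #I₀`) polynomials `P_j ∈ S[Y_{I₀}]` with `W(P_j(y_{I₀})) > 0`
such that every `Q ∈ S[Y_{I₀}]` with `W(Q(y_{I₀})) > 0` lies in `(P_1, …, P_m) + m_S·S[Y_{I₀}]`.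
On paper: `S[Y_{I₀}] → κ(W)`, `Y_i ↦ ȳ_i`, kills `m_S` and factors through `κ(S)[Y_{I₀}]`, where
its kernel is a maximal ideal (the `ȳ_i` are algebraic over `k ⊆ κ(S)`, so `κ(S)[ȳ]` is a field),
generated by `#I₀` elements (Matsumura, *Commutative Ring Theory*, Thm. 5.1); lift them.
[cite: CossartPiltant2008, Section 9, Lemma 9.4 (HAL p. 29 l. 48–49)] -/
def MonomialChartKernel : Prop :=
  ∀ (k L : Type u) [Field k] [Field L] [Algebra k L]
    (W : ValuationSubring L) (hk : ∀ c : k, algebraMap k L c ∈ W), residueTrdeg k W hk = 0 →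
    ∀ (S : Subalgebra k L) [IsLocalRing S], IsLocalModelOf k L W S →
    ∀ (d : ℕ) (y : Fin d → L), (∀ i, y i ∈ W) →
      ∃ (m : ℕ) (P : Fin m → MvPolynomial {i : Fin d // W.valuation (y i) = 1} S),
        Fintype.card {i : Fin d // W.valuation (y i) < 1} + m = d ∧
        (∀ j, W.valuation (MvPolynomial.aeval
          (fun i : {i : Fin d // W.valuation (y i) = 1} => y i.1) (P j)) < 1) ∧
        ∀ Q : MvPolynomial {i : Fin d // W.valuation (y i) = 1} S,
          W.valuation (MvPolynomial.aeval
            (fun i : {i : Fin d // W.valuation (y i) = 1} => y i.1) Q) < 1 →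
          Q ∈ Ideal.span (Set.range P) ⊔ Ideal.map MvPolynomial.C (maximalIdeal S)

end

/-! ## Polynomial bookkeeping on the affine chart `S[y]` -/

section Chart

variable {k L : Type u} [Field k] [Field L] [Algebra k L] (W : ValuationSubring L)

/-- Every element of `S̄ = S[y]` (the `k`-subalgebra `S ⊔ k[y]`) is a polynomial in `y` with
coefficients in `S`. [folklore] -/
private theorem exists_mvPolynomial_aeval_eq {S : Subalgebra k L} {d : ℕ} {y : Fin d → L} {a : L}
    (ha : a ∈ S ⊔ Algebra.adjoin k (Set.range y)) :
    ∃ Q : MvPolynomial (Fin d) S, MvPolynomial.aeval y Q = a := by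
  have hle : S ⊔ Algebra.adjoin k (Set.range y) ≤
      (MvPolynomial.aeval (R := S) y).range.restrictScalars k := by
    refine sup_le (fun s hs => ?_) (Algebra.adjoin_le ?_)
    · refine ⟨MvPolynomial.C ⟨s, hs⟩, ?_⟩
      show MvPolynomial.aeval y (MvPolynomial.C (⟨s, hs⟩ : S)) = s
      rw [MvPolynomial.aeval_C]
      rfl
    · rintro _ ⟨i, rfl⟩
      exact ⟨MvPolynomial.X i, MvPolynomial.aeval_X _ _⟩
  exact hle ha

/-- Values in a subalgebra: `eval₂` through the inclusion agrees with `aeval` in `L`.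
[folklore] -/
private theorem coe_eval₂_inclusion {S A : Subalgebra k L} (hSA : S ≤ A) {σ : Type*}
    (Y : σ → A) (Q : MvPolynomial σ S) :
    ((MvPolynomial.eval₂ (Subalgebra.inclusion hSA).toRingHom Y Q : A) : L) =
      MvPolynomial.aeval (fun i => (Y i : L)) Q := by
  classical
  rw [MvPolynomial.aeval_def, MvPolynomial.eval₂_eq, MvPolynomial.eval₂_eq,
    AddSubmonoidClass.coe_finsetSum]
  refine Finset.sum_congr rfl fun n _ => ?_
  rw [MulMemClass.coe_mul, SubmonoidClass.coe_finsetProd]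
  simp_rw [SubmonoidClass.coe_pow]
  rfl

/-- Reduction modulo the variables outside `p`: every polynomial in all the variables agrees,
modulo any ideal containing the values of the variables outside `p`, with a polynomial in the
variables in `p`. [folklore] -/
private theorem exists_eval₂_sub_eval₂_mem {R A : Type*} [CommRing R] [CommRing A] (ι : R →+* A)
    {d : ℕ} (Y : Fin d → A) (p : Fin d → Prop) (I : Ideal A) (hI : ∀ i, ¬ p i → Y i ∈ I)
    (Q : MvPolynomial (Fin d) R) :
    ∃ Q₀ : MvPolynomial {i : Fin d // p i} R,
      MvPolynomial.eval₂ ι Y Q - MvPolynomial.eval₂ ι (fun i => Y i.1) Q₀ ∈ I := by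
  induction Q using MvPolynomial.induction_on with
  | C c => exact ⟨MvPolynomial.C c, by rw [MvPolynomial.eval₂_C, MvPolynomial.eval₂_C, sub_self]; exact I.zero_mem⟩
  | add P Q hP hQ =>
    obtain ⟨P₀, hP₀⟩ := hP
    obtain ⟨Q₀, hQ₀⟩ := hQ
    refine ⟨P₀ + Q₀, ?_⟩
    rw [MvPolynomial.eval₂_add, MvPolynomial.eval₂_add, add_sub_add_comm]
    exact I.add_mem hP₀ hQ₀
  | mul_X P i hP =>
    obtain ⟨P₀, hP₀⟩ := hP
    by_cases hi : p i
    · refine ⟨P₀ * MvPolynomial.X ⟨i, hi⟩, ?_⟩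
      rw [MvPolynomial.eval₂_mul, MvPolynomial.eval₂_X, MvPolynomial.eval₂_mul,
        MvPolynomial.eval₂_X, ← sub_mul]
      exact I.mul_mem_right _ hP₀
    · refine ⟨0, ?_⟩
      rw [MvPolynomial.eval₂_zero, sub_zero, MvPolynomial.eval₂_mul, MvPolynomial.eval₂_X]
      exact I.mul_mem_left _ (hI i hi)

/-- Elements of an ideal of `A ⊆ W` generated by elements of positive value have positive
value. [folklore] -/
private theorem valuation_lt_one_of_mem_span {A : Subalgebra k L} (hAW : ∀ a ∈ A, a ∈ W)
    {T : Set L} (hT : ∀ t ∈ T, W.valuation t < 1) {b : A}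
    (hb : b ∈ Ideal.span {s : A | (s : L) ∈ T}) : W.valuation (b : L) < 1 := by
  induction hb using Submodule.span_induction with
  | mem s hs => exact hT _ hs
  | zero => rw [ZeroMemClass.coe_zero, map_zero]; exact zero_lt_one
  | add b c _ _ hb hc => rw [AddMemClass.coe_add]; exact Valuation.map_add_lt _ hb hc
  | smul r b _ hb =>
    rw [smul_eq_mul, MulMemClass.coe_mul, map_mul]
    calc W.valuation (r : L) * W.valuation (b : L) ≤ 1 * W.valuation (b : L) :=
          mul_le_mul' ((W.valuation_le_one_iff _).mpr (hAW _ r.2)) le_rfl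
      _ < 1 := by rw [one_mul]; exact hb

/-- The members of a regular system of parameters are non-zero (Krull: the maximal ideal of a
regular local ring of dimension `d` is not generated by fewer than `d` elements). [folklore] -/
private theorem ne_zero_of_span_eq_maximalIdeal_aux (S : Subalgebra k L) [IsRegularLocalRing S]
    {d : ℕ} {x : Fin d → L}
    (hspan : Ideal.span {s : S | (s : L) ∈ Set.range x} = maximalIdeal S)
    (hdim : ringKrullDim S = d) (j : Fin d) : x j ≠ 0 := by
  classical
  intro h0
  have hfin : {s : S | (s : L) ∈ Set.range x}.Finite :=
    (Set.finite_range x).preimage Subtype.val_injective.injOn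
  have h0T : (0 : S) ∈ {s : S | (s : L) ∈ Set.range x} := ⟨j, by rw [h0]; rfl⟩
  have hcard : ({s : S | (s : L) ∈ Set.range x} \ {0}).ncard + 1 ≤ d := by
    rw [Set.ncard_sdiff_singleton_add_one h0T hfin,
      ← Set.ncard_image_of_injective _ Subtype.val_injective]
    refine (Set.ncard_le_ncard ?_ (Set.finite_range x)).trans ?_
    · rintro _ ⟨s, hs, rfl⟩
      exact hs
    · calc (Set.range x).ncard ≤ (Set.univ : Set (Fin d)).ncard := by
            rw [← Set.image_univ]; exact Set.ncard_image_le Set.finite_univ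
        _ = d := by rw [Set.ncard_univ, Nat.card_eq_fintype_card, Fintype.card_fin]
  have hspan' : Ideal.span ({s : S | (s : L) ∈ Set.range x} \ {0}) = maximalIdeal S := by
    rw [← hspan, ← Ideal.span_insert_zero, Set.insert_sdiff_singleton, Set.insert_eq_of_mem h0T]
  have hle : ringKrullDim S ≤ (({s : S | (s : L) ∈ Set.range x} \ {0}).ncard : WithBot ℕ∞) := by
    refine (ringKrullDim_le_spanFinrank_maximalIdeal S).trans ?_
    rw [← hspan']
    exact_mod_cast Submodule.spanFinrank_span_le_ncard_of_finite (hfin.subset Set.sdiff_subset)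
  rw [hdim] at hle
  have hle' : d ≤ ({s : S | (s : L) ∈ Set.range x} \ {0}).ncard := by exact_mod_cast hle
  omega

end Chart

/-! ## Node N2a″ from N2a‴: "by (b)" (PROVED) -/

/-- **Node N2a″ PROVED from N2a‴.** [CP-I] Lemma 9.4, HAL p. 29 l. 48–49, the words "by (b)":
with `I₊ := {i | W(y_i) > 0}`, every `x_j = ∏_i y_i^{C_{ji}}` (`C = V⁻¹ ≥ 0`,
`eq_prod_pow_toNat_of_mul_eq_one`) involves some `y_i`, `i ∈ I₊` (else `W(x_j) = 0`), so
`m_S·S̄ ⊆ (y_{I₊})S̄`; every `a ∈ S̄ = S[y]` is `Q(y)` with `Q ∈ S[Y]`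
(`exists_mvPolynomial_aeval_eq`) and `Q(y) ≡ Q₀(y_{I₀})` modulo `(y_{I₊})` with `Q₀ ∈ S[Y_{I₀}]`
(`exists_eval₂_sub_eval₂_mem`); if `W(a) > 0` then `W(Q₀(y_{I₀})) > 0`, so by the leaf
`Q₀ ∈ (P_j) + m_S·S[Y_{I₀}]` and `a ∈ (y_{I₊}, P_j(y_{I₀}))S̄`.
[cite: CossartPiltant2008, Section 9, Lemma 9.4 (HAL p. 29 l. 48–49)] -/
theorem monomialChartIdeal_of_kernel (h : MonomialChartKernel.{u}) : MonomialChartIdeal.{u} := by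
  intro k L _ _ _ W hk hres S hSreg hS d x hxS hspanx hdimS V C hVC hC y hy hyW
  classical
  obtain ⟨m, P, hcard, hPval, hker⟩ := h k L W hk hres S hS d y hyW
  refine ⟨m, P, hcard, hPval, ?_⟩
  -- the affine chart `S̄ = S[y] ⊆ W`
  have hSA : S ≤ S ⊔ Algebra.adjoin k (Set.range y) := le_sup_left
  have hyA : ∀ i, y i ∈ S ⊔ Algebra.adjoin k (Set.range y) := fun i =>
    (le_sup_right : Algebra.adjoin k (Set.range y) ≤ _) (Algebra.subset_adjoin ⟨i, rfl⟩)
  have hyW' : Set.range y ⊆ (valuationSubalgebra W hk : Set L) := by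
    rintro _ ⟨i, rfl⟩
    exact hyW i
  have hAW : ∀ a ∈ S ⊔ Algebra.adjoin k (Set.range y), a ∈ W := fun a ha =>
    (sup_le (fun s hs => hS.mem_of_mem hs) (Algebra.adjoin_le hyW') :
      S ⊔ Algebra.adjoin k (Set.range y) ≤ valuationSubalgebra W hk) ha
  -- property (b): `x_j ∈ (y_{I₊})S̄`, hence `m_S ⊆ (y_{I₊}, P_j(y))S̄`
  have hx0 : ∀ j, x j ≠ 0 := ne_zero_of_span_eq_maximalIdeal_aux S hspanx hdimS
  have hxprod : ∀ j, x j = ∏ i, y i ^ (C j i).toNat := fun j =>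
    eq_prod_pow_toNat_of_mul_eq_one hx0 hVC hC hy j
  have hexists : ∀ j, ∃ i, W.valuation (y i) < 1 ∧ 0 < (C j i).toNat := by
    intro j
    by_contra hne
    have hzero : ∀ i, W.valuation (y i) < 1 → (C j i).toNat = 0 := fun i hi => by
      rcases Nat.eq_zero_or_pos (C j i).toNat with h0 | h0
      · exact h0
      · exact absurd ⟨i, hi, h0⟩ hne
    have hval : W.valuation (x j) = 1 := by
      rw [hxprod j, map_prod]
      refine Finset.prod_eq_one fun i _ => ?_
      rw [map_pow]
      by_cases hi : W.valuation (y i) < 1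
      · rw [hzero i hi, pow_zero]
      · rw [le_antisymm ((W.valuation_le_one_iff _).mpr (hyW i)) (not_lt.mp hi), one_pow]
    have hlt : W.valuation (x j) < 1 :=
      (hS.mem_maximalIdeal_iff ⟨x j, hxS j⟩).mp (by rw [← hspanx]; exact Ideal.subset_span ⟨j, rfl⟩)
    exact hlt.ne hval
  have hxI : ∀ j, Subalgebra.inclusion hSA ⟨x j, hxS j⟩ ∈ (Ideal.span {s : ↥(S ⊔ Algebra.adjoin k (Set.range y)) |
          (s : L) ∈ y '' {i | W.valuation (y i) < 1} ∪
            Set.range (fun j => MvPolynomial.aeval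
              (fun i : {i : Fin d // W.valuation (y i) = 1} => y i.1) (P j))}) := by
    intro j
    obtain ⟨i₁, hi₁, hpos⟩ := hexists j
    have hX : Subalgebra.inclusion hSA ⟨x j, hxS j⟩ = ∏ i, (fun i : Fin d => (⟨y i, hyA i⟩ : ↥(S ⊔ Algebra.adjoin k (Set.range y)))) i ^ (C j i).toNat := by
      apply Subtype.val_injective
      simp only [Subalgebra.coe_inclusion, SubmonoidClass.coe_finsetProd, SubmonoidClass.coe_pow]
      exact hxprod j
    rw [hX, ← Finset.mul_prod_erase Finset.univ (fun i => (fun i : Fin d => (⟨y i, hyA i⟩ : ↥(S ⊔ Algebra.adjoin k (Set.range y)))) i ^ (C j i).toNat)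
      (Finset.mem_univ i₁)]
    refine Ideal.mul_mem_right _ _ (Ideal.pow_mem_of_mem _ ?_ _ hpos)
    exact Ideal.subset_span (Or.inl ⟨i₁, hi₁, rfl⟩)
  have hmS : ∀ c : S, W.valuation (c : L) < 1 → Subalgebra.inclusion hSA c ∈ (Ideal.span {s : ↥(S ⊔ Algebra.adjoin k (Set.range y)) |
          (s : L) ∈ y '' {i | W.valuation (y i) < 1} ∪
            Set.range (fun j => MvPolynomial.aeval
              (fun i : {i : Fin d // W.valuation (y i) = 1} => y i.1) (P j))}) := by
    intro c hc
    have hcm : c ∈ Ideal.span {s : S | (s : L) ∈ Set.range x} := by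
      rw [hspanx]
      exact (hS.mem_maximalIdeal_iff c).mpr hc
    have hle : Ideal.span {s : S | (s : L) ∈ Set.range x} ≤
        Ideal.comap (Subalgebra.inclusion hSA) (Ideal.span {s : ↥(S ⊔ Algebra.adjoin k (Set.range y)) |
          (s : L) ∈ y '' {i | W.valuation (y i) < 1} ∪
            Set.range (fun j => MvPolynomial.aeval
              (fun i : {i : Fin d // W.valuation (y i) = 1} => y i.1) (P j))}) := by
      rw [Ideal.span_le]
      rintro s ⟨j, hj⟩
      have hsx : s = ⟨x j, hxS j⟩ := Subtype.ext hj.symm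
      rw [SetLike.mem_coe, Ideal.mem_comap, hsx]
      exact hxI j
    exact hle hcm
  -- the generators have positive value, hence so does every element of the ideal
  have hIval : ∀ b ∈ (Ideal.span {s : ↥(S ⊔ Algebra.adjoin k (Set.range y)) |
          (s : L) ∈ y '' {i | W.valuation (y i) < 1} ∪
            Set.range (fun j => MvPolynomial.aeval
              (fun i : {i : Fin d // W.valuation (y i) = 1} => y i.1) (P j))}), W.valuation (b : L) < 1 := fun b hb => by
    refine valuation_lt_one_of_mem_span W hAW ?_ hb
    rintro _ (⟨i, hi, rfl⟩ | ⟨j, rfl⟩)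
    · exact hi
    · exact hPval j
  -- every `a ∈ S̄` is `Q(y)`, and `Q(y) ≡ Q₀(y_{I₀})` modulo the ideal
  intro a ha
  obtain ⟨Q, hQ⟩ := exists_mvPolynomial_aeval_eq a.2
  have haQ : a = MvPolynomial.eval₂ (Subalgebra.inclusion hSA).toRingHom (fun i : Fin d => (⟨y i, hyA i⟩ : ↥(S ⊔ Algebra.adjoin k (Set.range y)))) Q :=
    Subtype.ext (by rw [coe_eval₂_inclusion]; exact hQ.symm)
  obtain ⟨Q₀, hQ₀⟩ := exists_eval₂_sub_eval₂_mem (Subalgebra.inclusion hSA).toRingHom (fun i : Fin d => (⟨y i, hyA i⟩ : ↥(S ⊔ Algebra.adjoin k (Set.range y))))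
    (fun i => W.valuation (y i) = 1) (Ideal.span {s : ↥(S ⊔ Algebra.adjoin k (Set.range y)) |
          (s : L) ∈ y '' {i | W.valuation (y i) < 1} ∪
            Set.range (fun j => MvPolynomial.aeval
              (fun i : {i : Fin d // W.valuation (y i) = 1} => y i.1) (P j))}) (fun i hi => Ideal.subset_span (Or.inl ⟨i,
      lt_of_le_of_ne ((W.valuation_le_one_iff _).mpr (hyW i)) hi, rfl⟩)) Q
  -- `W(Q₀(y_{I₀})) > 0`, so the leaf applies to `Q₀`
  have hQ₀val : W.valuation (MvPolynomial.aeval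
      (fun i : {i : Fin d // W.valuation (y i) = 1} => y i.1) Q₀) < 1 := by
    have heq : MvPolynomial.eval₂ (Subalgebra.inclusion hSA).toRingHom (fun i : {i : Fin d // W.valuation (y i) = 1} =>
          (⟨y i.1, hyA i.1⟩ : ↥(S ⊔ Algebra.adjoin k (Set.range y)))) Q₀ =
        a - (MvPolynomial.eval₂ (Subalgebra.inclusion hSA).toRingHom (fun i : Fin d => (⟨y i, hyA i⟩ : ↥(S ⊔ Algebra.adjoin k (Set.range y)))) Q - MvPolynomial.eval₂ (Subalgebra.inclusion hSA).toRingHom (fun i : {i : Fin d // W.valuation (y i) = 1} =>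
          (⟨y i.1, hyA i.1⟩ : ↥(S ⊔ Algebra.adjoin k (Set.range y)))) Q₀) := by
      rw [haQ, sub_sub_cancel]
    have h1 := coe_eval₂_inclusion hSA (fun i : {i : Fin d // W.valuation (y i) = 1} =>
          (⟨y i.1, hyA i.1⟩ : ↥(S ⊔ Algebra.adjoin k (Set.range y)))) Q₀
    rw [heq, AddSubgroupClass.coe_sub] at h1
    rw [← h1]
    exact Valuation.map_sub_lt _ ha (hIval _ hQ₀)
  have hQ₀mem := hker Q₀ hQ₀val
  -- push the membership through `Q ↦ Q(y_{I₀}) ∈ S̄`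
  have hle : Ideal.span (Set.range P) ⊔ Ideal.map MvPolynomial.C (maximalIdeal S) ≤
      Ideal.comap (MvPolynomial.eval₂Hom (Subalgebra.inclusion hSA).toRingHom (fun i : {i : Fin d // W.valuation (y i) = 1} =>
          (⟨y i.1, hyA i.1⟩ : ↥(S ⊔ Algebra.adjoin k (Set.range y))))) (Ideal.span {s : ↥(S ⊔ Algebra.adjoin k (Set.range y)) |
          (s : L) ∈ y '' {i | W.valuation (y i) < 1} ∪
            Set.range (fun j => MvPolynomial.aeval
              (fun i : {i : Fin d // W.valuation (y i) = 1} => y i.1) (P j))}) := by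
    refine sup_le ?_ ?_
    · rw [Ideal.span_le]
      rintro _ ⟨j, rfl⟩
      rw [SetLike.mem_coe, Ideal.mem_comap]
      refine Ideal.subset_span (Or.inr ⟨j, ?_⟩)
      rw [MvPolynomial.coe_eval₂Hom, coe_eval₂_inclusion]
    · rw [Ideal.map_le_iff_le_comap]
      intro c hc
      rw [Ideal.mem_comap, Ideal.mem_comap, MvPolynomial.eval₂Hom_C]
      exact hmS c ((hS.mem_maximalIdeal_iff c).mp hc)
  have hQ₀I : MvPolynomial.eval₂ (Subalgebra.inclusion hSA).toRingHom (fun i : {i : Fin d // W.valuation (y i) = 1} =>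
          (⟨y i.1, hyA i.1⟩ : ↥(S ⊔ Algebra.adjoin k (Set.range y)))) Q₀ ∈ (Ideal.span {s : ↥(S ⊔ Algebra.adjoin k (Set.range y)) |
          (s : L) ∈ y '' {i | W.valuation (y i) < 1} ∪
            Set.range (fun j => MvPolynomial.aeval
              (fun i : {i : Fin d // W.valuation (y i) = 1} => y i.1) (P j))}) := by
    have h1 := hle hQ₀mem
    rw [Ideal.mem_comap, MvPolynomial.coe_eval₂Hom] at h1
    exact h1
  have ha' : a = (MvPolynomial.eval₂ (Subalgebra.inclusion hSA).toRingHom (fun i : Fin d => (⟨y i, hyA i⟩ : ↥(S ⊔ Algebra.adjoin k (Set.range y)))) Q - MvPolynomial.eval₂ (Subalgebra.inclusion hSA).toRingHom (fun i : {i : Fin d // W.valuation (y i) = 1} =>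
          (⟨y i.1, hyA i.1⟩ : ↥(S ⊔ Algebra.adjoin k (Set.range y)))) Q₀) +
      MvPolynomial.eval₂ (Subalgebra.inclusion hSA).toRingHom (fun i : {i : Fin d // W.valuation (y i) = 1} =>
          (⟨y i.1, hyA i.1⟩ : ↥(S ⊔ Algebra.adjoin k (Set.range y)))) Q₀ := by
    rw [sub_add_cancel]
    exact haQ
  rw [ha']
  exact Ideal.add_mem _ hQ₀ hQ₀I

/-! ## Re-threading through the kernel leaf -/

section Rethreaded

/-- **Node N2a′ `MonomialChartCentreSelf` from N2a‴.**
[cite: CossartPiltant2008, Section 9, Lemma 9.4 (HAL p. 29 l. 48–49)] -/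
theorem monomialChartCentreSelf_of_kernel (h : MonomialChartKernel.{u}) :
    MonomialChartCentreSelf.{u} :=
  monomialChartCentreSelf_of_ideal (monomialChartIdeal_of_kernel h)

/-- **Node N2 `MonomialChartRegular` from N2a‴.**
[cite: CossartPiltant2008, Section 9, Lemma 9.4 (HAL p. 29 l. 48–59)] -/
theorem monomialChartRegular_of_kernel (h : MonomialChartKernel.{u}) : MonomialChartRegular.{u} :=
  monomialChartRegular_of_ideal (monomialChartIdeal_of_kernel h)

/-- **The Roots leaf of Lemma 9.4 (HAL p. 29 l. 14–65) from the kernel leaf `MonomialChartKernel`**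
— the single hypothesis-only statement left below it: no Galois group, no coefficients, no
localisation, no parameters `x` or matrix `V`.
[cite: CossartPiltant2008, Lemma 9.4 proof (HAL p. 29, l. 14–65)] -/
theorem tamePrimeDescentViaStableModelRoots_of_kernel (h : MonomialChartKernel.{u}) :
    TamePrimeDescentViaStableModelRoots.{u} :=
  tamePrimeDescentViaStableModelRoots_of_ideal (monomialChartIdeal_of_kernel h)

/-- **Lemma 9.4 from Cor. 6.3, Prop. 9.3, the kernel leaf and (S3\*) for inertial `W`.**
[cite: CossartPiltant2008, Lemma 9.4 (HAL pp. 28–29)] -/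
theorem tamePrimeDescent_of_kernel_of_inertia (h63 : ClimbToInertiaField.{u})
    (h93 : DescentBelowInertiaField.{u}) (n : MonomialChartKernel.{u})
    (h₂ : GStableUniformizationInertial.{u}) : TamePrimeDescent.{u} :=
  tamePrimeDescent_of_ideal_of_inertia h63 h93 (monomialChartIdeal_of_kernel n) h₂

/-- **[CP-I] Thm. 2.1 VERBATIM for reduced quasi-projective threefolds —
`resolutionQuasiProjectiveThreefolds_of_printedLeaves_residuals_ideal` with the §9 leaf reduced
to the kernel leaf.**
[cite: CossartPiltant2008, Thm 2.1 (HAL p. 3)] [cite: CossartPiltant2009, Theorem (p. 1839)]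
[cite: CossartJannsenSaito2020, Introduction Thm. 1, Thm. 1.2] -/
theorem resolutionQuasiProjectiveThreefolds_of_printedLeaves_residuals_kernel
    (h49 : RefinedPatchingQuasiProjective.{u}) (hP : CossartPiltant2019Principalization.{u})
    (h83 : PrimeDegreeAscent.{u}) (h93 : DescentBelowInertiaField.{u})
    (n : MonomialChartKernel.{u})
    (hFu : PrimaryTransformRankOne.{u}) (hBPR : BenitoPiltantReguera2022QuadraticSequence.{u})
    (hnd : GStableUniformizationInertialRankOneNonDiscrete.{u})
    (hdi : GStableUniformizationInertialRankOneDiscreteImperfect.{u})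
    (cp2 : CossartPiltant2009Main.{u}) (hE : CossartJannsenSaito2020Embedded.{u})
    (h36 : CossartJannsenSaito2020Sequence.{u}) : ResolutionQuasiProjectiveThreefolds.{u} :=
  resolutionQuasiProjectiveThreefolds_of_printedLeaves_residuals_ideal h49 hP h83 h93
    (monomialChartIdeal_of_kernel n) hFu hBPR hnd hdi cp2 hE h36

/-- **Both halves of the 2008 programme's top statement —
`cp2008_of_printedLeaves_residuals_ideal` with the §9 leaf reduced to the kernel leaf.**
[cite: CossartPiltant2008, Thm 2.1 and Thm 7.2 (HAL pp. 3–4)] [cite: CossartPiltant2009, Theorem (p. 1839)]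
[cite: CossartJannsenSaito2020, Thm. 1.2] -/
theorem cp2008_of_printedLeaves_residuals_kernel (p49 : RefinedPatching.{u})
    (hP : CossartPiltant2019Principalization.{u}) (h83 : PrimeDegreeAscent.{u})
    (h93 : DescentBelowInertiaField.{u}) (n : MonomialChartKernel.{u})
    (hFu : PrimaryTransformRankOne.{u})
    (hBPR : BenitoPiltantReguera2022QuadraticSequence.{u})
    (hnd : GStableUniformizationInertialRankOneNonDiscrete.{u})
    (hdi : GStableUniformizationInertialRankOneDiscreteImperfect.{u})
    (cp2 : CossartPiltant2009Main.{u}) (h36 : CossartJannsenSaito2020General.{u})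
    (p41 : CossartJannsenSaito2020Embedded.{u}) :
    ResolutionAffineThreefolds.{u} ∧ LU3DiffFinite.{u} :=
  cp2008_of_printedLeaves_residuals_ideal p49 hP h83 h93 (monomialChartIdeal_of_kernel n)
    hFu hBPR hnd hdi cp2 h36 p41

/-- **[CP-I] Thm. 2.1 in universe `0` with the discrete-imperfect residual reduced to its core via
Knaf–Kuhlmann — `resolutionQuasiProjectiveThreefolds_of_printedLeaves_residuals₀_ideal` with the
§9 leaf reduced to the kernel leaf.**
[cite: CossartPiltant2008, Thm 2.1 (HAL p. 3)] [cite: KnafKuhlmann2009, Thm. 1.5]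
[cite: CossartJannsenSaito2020, Introduction Thm. 1, Thm. 1.2] -/
theorem resolutionQuasiProjectiveThreefolds_of_printedLeaves_residuals₀_kernel
    (h49 : RefinedPatchingQuasiProjective.{0}) (hP : CossartPiltant2019Principalization.{0})
    (h83 : PrimeDegreeAscent.{0}) (h93 : DescentBelowInertiaField.{0})
    (n : MonomialChartKernel.{0})
    (hFu : PrimaryTransformRankOne.{0}) (hKK : KnafKuhlmann2009MonogenicCompletion)
    (hBPR : BenitoPiltantReguera2022QuadraticSequence.{0})
    (hnd : GStableUniformizationInertialRankOneNonDiscrete.{0})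
    (hdic : GStableUniformizationInertialRankOneDiscreteImperfectCore)
    (cp2 : CossartPiltant2009Main.{0}) (hE : CossartJannsenSaito2020Embedded.{0})
    (h36 : CossartJannsenSaito2020Sequence.{0}) : ResolutionQuasiProjectiveThreefolds.{0} :=
  resolutionQuasiProjectiveThreefolds_of_printedLeaves_residuals₀_ideal h49 hP h83 h93
    (monomialChartIdeal_of_kernel n) hFu hKK hBPR hnd hdic cp2 hE h36

end Rethreaded

end Literature.AlgebraicGeometry.CossartPiltant200819.CP2008
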